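import Mathlib.Analysis.Calculus.BumpFunction.InnerProduct
import Mathlib.Analysis.SpecialFunctions.Pow.Deriv
import Literature.Probability.RandomPlanarGeometry.StationaryAngleTimeScale
import HarnessLib

/-!
# The tilt function of the SLE_κ(ρ) angle diffusion: `g = sin(x/2)^{-ρ/κ}`, smoothly localised

Topic `Probability/RandomPlanarGeometry`; theorems only (the function is delivered existentially),
sequel of `WholePlaneSLE` / `StationaryAngleTimeScale`. The generators of the SLE_κ(ρ) angle
diffusions (`angleGenerator κ ρ f = (κ/2) f'' + ((ρ+2)/2) cot(x/2) f'`, Miller–Sheffield (2013),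
§2.1.2, eq. (2.5)) for two values of `ρ` differ by a first-order term which is a logarithmic
derivative:

  `L_ρ f - L_0 f = (ρ/2) cot(x/2) f' = -κ (h'/h) f'`,   `h(x) = sin(x/2)^{-ρ/κ}`,

so that `L_0` is the Doob `h`-transform of `L_ρ`: `L_ρ(hf) - (L_ρ h/h) hf = h L_0 f`. This is
the device by which the force-point drift of radial SLE_κ(ρ) is removed by an exponential change of
measure without stochastic integrals (`MartingaleProblemTilting`), in the spirit of the absolute
continuity "discussion after (2.5)" of Miller–Sheffield (2013), §2.1.2 (there via Girsanov). Since
`h` degenerates at `{0, 2π}`, we localise: for `0 < ε < π/2` we produce (`exists_angleTilt`) a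
function `g` which is `C²`, equal to `1` off `[ε/2, 2π - ε/2]`, bounded above and below by positive
constants, with `g = h` (up to a harmless normalisation, none here) near every point of
`(ε, 2π - ε)`, together with the bounded continuous potential `V = L_ρ g / g`, such that

* `angleGenerator κ ρ (g - 1) = V g` (so `g(X_t) - g(X_0) - ∫₀ᵗ (Vg)(X_s) ds` is a martingale under
  any solution of the `(κ, ρ)` martingale problem);
* for every `C²` test function `f` supported in `(ε, 2π - ε)`:
  `angleGenerator κ ρ (g f) - V g f = g · angleGenerator κ 0 f` (the `h`-transform identity).

Everything is proved; no definition and no named fact is introduced.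

## References

* J. Miller, S. Sheffield, *Imaginary geometry IV*, PTRF 169 (2017), arXiv:1302.4738, §2.1.2,
  eq. (2.5) and the discussion following it. [MillerSheffield2013]
* Z. Palmowski, T. Rolski, *A technique for exponential change of measure for Markov processes*,
  Bernoulli 8 (2002), §3–4 (the generator `A^h f = h⁻¹[A(fh) - f Ah]`). [PalmowskiRolski2002]
-/

noncomputable section

open Set Filter Topology Metric Real

namespace Literature.Probability.RandomPlanarGeometry

open scoped NNReal

/-! ### Calculus of `h(x) = sin(x/2)^p` -/

section SinPow

variable {p : ℝ}

/-- `sin(x/2) > 0` on `(0, 2π)`. [folklore] -/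
theorem sin_half_pos {x : ℝ} (hx : x ∈ Ioo 0 (2 * π)) : 0 < Real.sin (x / 2) :=
  Real.sin_pos_of_pos_of_lt_pi (by linarith [hx.1]) (by linarith [hx.2])

/-- **`(sin(x/2)^p)' = (p/2) cot(x/2) sin(x/2)^p`** on `(0, 2π)`. [folklore] -/
theorem hasDerivAt_sin_half_rpow {x : ℝ} (hx : x ∈ Ioo 0 (2 * π)) :
    HasDerivAt (fun x ↦ Real.sin (x / 2) ^ p) (p / 2 * Real.cot (x / 2) * Real.sin (x / 2) ^ p) x := by
  have hsin := sin_half_pos hx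
  have h1 : HasDerivAt (fun x : ℝ ↦ x / 2) (1 / 2) x := (hasDerivAt_id x).div_const 2
  have h2 : HasDerivAt (fun x ↦ Real.sin (x / 2)) (Real.cos (x / 2) * (1 / 2)) x := h1.sin
  have h3 := h2.rpow_const (p := p) (Or.inl hsin.ne')
  refine h3.congr_deriv ?_
  rw [Real.rpow_sub_one hsin.ne', Real.cot_eq_cos_div_sin]
  field_simp

/-- `x ↦ sin(x/2)^p` is smooth on `(0, 2π)`. [folklore] -/
theorem contDiffAt_sin_half_rpow {n : WithTop ℕ∞} {x : ℝ} (hx : x ∈ Ioo 0 (2 * π)) :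
    ContDiffAt ℝ n (fun x ↦ Real.sin (x / 2) ^ p) x :=
  (Real.contDiffAt_rpow_const_of_ne (p := p) (sin_half_pos hx).ne').comp x
    (Real.contDiff_sin.comp (contDiff_id.div_const 2)).contDiffAt

/-- `x ↦ sin(x/2)^p` is positive on `(0, 2π)`. [folklore] -/
theorem sin_half_rpow_pos {x : ℝ} (hx : x ∈ Ioo 0 (2 * π)) : 0 < Real.sin (x / 2) ^ p :=
  Real.rpow_pos_of_pos (sin_half_pos hx) p

end SinPow

/-! ### The localised tilt function `g = 1 + χ (h - 1)` -/

section Tilt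

variable {p : ℝ} {χ : ContDiffBump (π : ℝ)}

/-- The closed ball of the bump lies in `(0, 2π)` when `rOut < π`. [folklore] -/
theorem closedBall_subset_Ioo (hχ : χ.rOut < π) : closedBall (π : ℝ) χ.rOut ⊆ Ioo 0 (2 * π) := by
  intro x hx
  rw [mem_closedBall, Real.dist_eq, abs_le] at hx
  constructor <;> linarith [hx.1, hx.2]

/-- Off the closed ball the bump vanishes near the point. [folklore] -/
theorem bump_eventuallyEq_zero {x : ℝ} (hx : x ∉ closedBall (π : ℝ) χ.rOut) : (χ : ℝ → ℝ) =ᶠ[𝓝 x] 0 := by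
  rw [← χ.tsupport_eq] at hx
  exact notMem_tsupport_iff_eventuallyEq.1 hx

/-- **The localised tilt function is `C²`** (indeed smooth): `g = 1 + χ (h - 1)` with
`h = sin(·/2)^p`, `χ` a smooth bump around `π` with `rOut < π`. [folklore] -/
theorem contDiff_tilt (hχ : χ.rOut < π) {n : ℕ∞} :
    ContDiff ℝ n fun x ↦ 1 + χ x * (Real.sin (x / 2) ^ p - 1) := by
  refine contDiff_iff_contDiffAt.2 fun x ↦ ?_
  by_cases hx : x ∈ closedBall (π : ℝ) χ.rOut
  · have hxI := closedBall_subset_Ioo hχ hx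
    have h1 : ContDiffAt ℝ n (χ : ℝ → ℝ) x := (χ.contDiff (n := n)).contDiffAt
    have h2 : ContDiffAt ℝ n (fun x ↦ Real.sin (x / 2) ^ p - 1) x :=
      (contDiffAt_sin_half_rpow hxI).sub contDiffAt_const
    exact contDiffAt_const.add (h1.mul h2)
  · have hev : (fun x ↦ 1 + χ x * (Real.sin (x / 2) ^ p - 1)) =ᶠ[𝓝 x] fun _ ↦ (1 : ℝ) := by
      filter_upwards [bump_eventuallyEq_zero hx] with y hy
      simp [hy]
    exact contDiffAt_const.congr_of_eventuallyEq hev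

/-- Near a point of the inner ball the tilt function is `h = sin(·/2)^p`. [folklore] -/
theorem tilt_eventuallyEq {x : ℝ} (hx : x ∈ ball (π : ℝ) χ.rIn) :
    (fun x ↦ 1 + χ x * (Real.sin (x / 2) ^ p - 1)) =ᶠ[𝓝 x] fun x ↦ Real.sin (x / 2) ^ p := by
  filter_upwards [χ.eventuallyEq_one_of_mem_ball hx] with y hy
  simp only [hy, Pi.one_apply, one_mul]
  ring

/-- **The logarithmic derivative of the tilt function on the inner ball**:
`g'(x) = (p/2) cot(x/2) g(x)`. [folklore] -/
theorem hasDerivAt_tilt (hχ : χ.rOut < π) {x : ℝ} (hx : x ∈ ball (π : ℝ) χ.rIn) :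
    HasDerivAt (fun x ↦ 1 + χ x * (Real.sin (x / 2) ^ p - 1))
      (p / 2 * Real.cot (x / 2) * (1 + χ x * (Real.sin (x / 2) ^ p - 1))) x := by
  have hxI : x ∈ Ioo 0 (2 * π) :=
    closedBall_subset_Ioo hχ (ball_subset_closedBall (ball_subset_ball χ.rIn_lt_rOut.le hx))
  have h := (hasDerivAt_sin_half_rpow (p := p) hxI).congr_of_eventuallyEq (tilt_eventuallyEq hx)
  refine h.congr_deriv ?_
  rw [χ.one_of_mem_closedBall (ball_subset_closedBall hx)]
  ring

/-- Off the closed ball the tilt function is `1`. [folklore] -/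
theorem tilt_eq_one {x : ℝ} (hx : x ∉ closedBall (π : ℝ) χ.rOut) :
    1 + χ x * (Real.sin (x / 2) ^ p - 1) = 1 := by
  rw [χ.zero_of_le_dist (le_of_not_ge fun h ↦ hx (mem_closedBall.2 h))]
  ring

/-- **Two-sided bounds for the tilt function**: there are `0 < c ≤ C` with `c ≤ g ≤ C` on `ℝ`
(`g` is a convex combination of `1` and the positive continuous `h` on the compact closed ball,
and `1` elsewhere). [folklore] -/
theorem exists_bounds_tilt (hχ : χ.rOut < π) :
    ∃ c C : ℝ, 0 < c ∧ (∀ x, c ≤ 1 + χ x * (Real.sin (x / 2) ^ p - 1)) ∧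
      ∀ x, |1 + χ x * (Real.sin (x / 2) ^ p - 1)| ≤ C := by
  set K := closedBall (π : ℝ) χ.rOut with hK
  have hKc : IsCompact K := isCompact_closedBall _ _
  have hKne : K.Nonempty := ⟨π, mem_closedBall_self (χ.rIn_pos.trans χ.rIn_lt_rOut).le⟩
  have hcont : ContinuousOn (fun x ↦ Real.sin (x / 2) ^ p) K := fun x hx ↦
    (contDiffAt_sin_half_rpow (n := 0) (closedBall_subset_Ioo hχ hx)).continuousAt.continuousWithinAt
  obtain ⟨xm, hxm, hmin⟩ := hKc.exists_isMinOn hKne hcont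
  obtain ⟨xM, hxM, hmax⟩ := hKc.exists_isMaxOn hKne hcont
  set m := Real.sin (xm / 2) ^ p with hm
  set M := Real.sin (xM / 2) ^ p with hM
  have hmpos : 0 < m := sin_half_rpow_pos (closedBall_subset_Ioo hχ hxm)
  refine ⟨min 1 m, max 1 M, lt_min one_pos hmpos, fun x ↦ ?_, fun x ↦ ?_⟩
  · by_cases hx : x ∈ K
    · have h1 : m ≤ Real.sin (x / 2) ^ p := hmin hx
      have hχ0 : 0 ≤ χ x := χ.nonneg
      have hχ1 : χ x ≤ 1 := χ.le_one
      have : 1 + χ x * (Real.sin (x / 2) ^ p - 1) = (1 - χ x) * 1 + χ x * Real.sin (x / 2) ^ p := by ring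
      rw [this]
      calc min 1 m = (1 - χ x) * min 1 m + χ x * min 1 m := by ring
        _ ≤ (1 - χ x) * 1 + χ x * Real.sin (x / 2) ^ p :=
          add_le_add (mul_le_mul_of_nonneg_left (min_le_left _ _) (by linarith))
            (mul_le_mul_of_nonneg_left ((min_le_right _ _).trans h1) hχ0)
    · rw [tilt_eq_one hx]; exact min_le_left _ _
  · by_cases hx : x ∈ K
    · have h1 : Real.sin (x / 2) ^ p ≤ M := hmax hx
      have h0 : 0 ≤ Real.sin (x / 2) ^ p := (sin_half_rpow_pos (closedBall_subset_Ioo hχ hx)).le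
      have hχ0 : 0 ≤ χ x := χ.nonneg
      have hχ1 : χ x ≤ 1 := χ.le_one
      rw [abs_le]
      constructor
      · have : 0 ≤ (1 - χ x) * 1 + χ x * Real.sin (x / 2) ^ p :=
          add_nonneg (by linarith) (mul_nonneg hχ0 h0)
        have hM1 : (0 : ℝ) ≤ max 1 M := le_max_of_le_left zero_le_one
        nlinarith
      · calc 1 + χ x * (Real.sin (x / 2) ^ p - 1) = (1 - χ x) * 1 + χ x * Real.sin (x / 2) ^ p := by ring
          _ ≤ (1 - χ x) * max 1 M + χ x * max 1 M :=
            add_le_add (mul_le_mul_of_nonneg_left (le_max_left _ _) (by linarith))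
              (mul_le_mul_of_nonneg_left (h1.trans (le_max_right _ _)) hχ0)
          _ = max 1 M := by ring
    · rw [tilt_eq_one hx, abs_one]; exact le_max_left _ _

/-- The compactly supported part `g - 1 = χ (h - 1)` is `C²` with support in the closed ball,
hence in `(0, 2π)`. [folklore] -/
theorem tsupport_tilt_sub_one_subset (hχ : χ.rOut < π) :
    tsupport (fun x ↦ χ x * (Real.sin (x / 2) ^ p - 1)) ⊆ Ioo 0 (2 * π) := by
  refine Subset.trans ?_ ((χ.tsupport_eq.le).trans (closedBall_subset_Ioo hχ))
  exact tsupport_mul_subset_left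

/-! ### Leibniz rules at a point -/

/-- First derivative of a product at a point. [folklore] -/
theorem deriv_mul_apply {G F : ℝ → ℝ} {x : ℝ} (hG : DifferentiableAt ℝ G x) (hF : DifferentiableAt ℝ F x) :
    deriv (fun x ↦ G x * F x) x = deriv G x * F x + G x * deriv F x :=
  deriv_fun_mul hG hF

/-- Second derivative of a product at a point (`C²` factors):
`(GF)'' = G'' F + 2 G' F' + G F''`. [folklore] -/
theorem iteratedDeriv_two_mul_apply {G F : ℝ → ℝ} {x : ℝ} (hG : ContDiffAt ℝ 2 G x) (hF : ContDiffAt ℝ 2 F x) :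
    iteratedDeriv 2 (fun x ↦ G x * F x) x =
      iteratedDeriv 2 G x * F x + 2 * deriv G x * deriv F x + G x * iteratedDeriv 2 F x := by
  rw [iteratedDeriv_fun_mul hG hF]
  simp [Finset.sum_range_succ, iteratedDeriv_one, iteratedDeriv_zero]
  ring

end Tilt

/-! ### The tilt function, packaged -/

section Exists

/-- **The localised tilt function of the SLE_κ(ρ) angle diffusion.** For `κ > 0`, `ρ ∈ ℝ` and
`0 < ε < π` there are continuous `g, V : ℝ → ℝ` and constants `0 < c`, `C_g`, `C_V` with
`c ≤ g ≤ C_g`, `|V| ≤ C_V`, such that `g - 1` is `C²` with compact support in `(0, 2π)`,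
`angleGenerator κ ρ (g - 1) = V g` (`V = L_ρ g / g`), and for every `C²` test function `F`
supported in `(ε, 2π - ε)` the product `g F` is `C²` with `tsupport (gF) ⊆ tsupport F` and the
**`h`-transform identity** `angleGenerator κ ρ (gF) - V g F = g · angleGenerator κ 0 F` holds on
`ℝ` (on `(ε, 2π - ε)` one has `g = sin(·/2)^{-ρ/κ}` locally, so `κ g'/g = -(ρ/2) cot(·/2)`, which
is `L_ρ - L_0` on first-order terms; Miller–Sheffield (2013), §2.1.2, eq. (2.5)).
[cite: MillerSheffield2013, §2.1.2] -/
theorem exists_angleTilt (κ : ℝ≥0) (ρ : ℝ) (hκ : 0 < κ) {ε : ℝ} (hε : 0 < ε) (hεπ : ε < π) :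
    ∃ g V : ℝ → ℝ, ∃ c Cg CV : ℝ, 0 < c ∧ Continuous g ∧ Continuous V ∧ (∀ x, c ≤ g x) ∧
      (∀ x, |g x| ≤ Cg) ∧ (∀ x, |V x| ≤ CV) ∧
      ContDiff ℝ 2 (fun x ↦ g x - 1) ∧ HasCompactSupport (fun x ↦ g x - 1) ∧
      tsupport (fun x ↦ g x - 1) ⊆ Ioo 0 (2 * π) ∧
      (∀ x, angleGenerator κ ρ (fun x ↦ g x - 1) x = V x * g x) ∧
      ∀ F : ℝ → ℝ, ContDiff ℝ 2 F → tsupport F ⊆ Ioo ε (2 * π - ε) →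
        ContDiff ℝ 2 (fun x ↦ g x * F x) ∧ tsupport (fun x ↦ g x * F x) ⊆ tsupport F ∧
          ∀ x, angleGenerator κ ρ (fun x ↦ g x * F x) x - V x * (g x * F x) =
            g x * angleGenerator κ 0 F x := by
  -- the bump `χ = 1` on `[ε, 2π - ε]`, supported in `(ε/2, 2π - ε/2)`, and the exponent `p = -ρ/κ`
  let χ : ContDiffBump (π : ℝ) := ⟨π - ε, π - ε / 2, by linarith, by linarith⟩
  have hχ : χ.rOut < π := by change π - ε / 2 < π; linarith
  have hrIn : χ.rIn = π - ε := rfl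
  set p : ℝ := -ρ / κ with hp
  have hκp : (κ : ℝ) * (p / 2) = -(ρ / 2) := by
    rw [hp]; field_simp
  set g : ℝ → ℝ := fun x ↦ 1 + χ x * (Real.sin (x / 2) ^ p - 1) with hgdef
  set g₁ : ℝ → ℝ := fun x ↦ χ x * (Real.sin (x / 2) ^ p - 1) with hg₁def
  have hg₁g : (fun x ↦ g x - 1) = g₁ := by funext x; simp [hgdef, hg₁def]
  have hgC : ContDiff ℝ 2 g := contDiff_tilt hχ
  have hg₁C : ContDiff ℝ 2 g₁ := by rw [← hg₁g]; exact hgC.sub contDiff_const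
  have hg₁supp : tsupport g₁ ⊆ Ioo 0 (2 * π) := tsupport_tilt_sub_one_subset hχ
  have hg₁cpt : HasCompactSupport g₁ := by
    refine HasCompactSupport.of_support_subset_isCompact (isCompact_closedBall (π : ℝ) χ.rOut) ?_
    refine (subset_tsupport _).trans ?_
    exact tsupport_mul_subset_left.trans χ.tsupport_eq.le
  obtain ⟨c, Cg, hc, hgc, hgb⟩ := exists_bounds_tilt (p := p) hχ
  have hg0 : ∀ x, g x ≠ 0 := fun x ↦ (hc.trans_le (hgc x)).ne'
  have hgcont : Continuous g := hgC.continuous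
  -- the potential `V = L_ρ g₁ / g`
  set V : ℝ → ℝ := fun x ↦ angleGenerator κ ρ g₁ x / g x with hVdef
  have hLg₁ : Continuous (angleGenerator κ ρ g₁) := continuous_angleGenerator hg₁C hg₁supp
  obtain ⟨CL, hCL0, hCL⟩ := exists_bound_angleGenerator (κ := κ) (ρ := ρ) hg₁C hg₁cpt hg₁supp
  have hVcont : Continuous V := hLg₁.div hgcont hg0
  have hVb : ∀ x, |V x| ≤ CL / c := fun x ↦ by
    simp only [hVdef]
    rw [abs_div, abs_of_pos (hc.trans_le (hgc x))]
    exact div_le_div₀ hCL0 (hCL x) hc (hgc x)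
  -- derivatives of `g` and `g₁` agree
  have hDg₁ : ∀ x, deriv g₁ x = deriv g x := fun x ↦ by
    rw [← hg₁g]; exact deriv_sub_const _
  have hD2g₁ : ∀ x, iteratedDeriv 2 g₁ x = iteratedDeriv 2 g x := fun x ↦ by
    have : g₁ = fun x ↦ (-1 : ℝ) + g x := by funext x; rw [← hg₁g]; ring
    rw [this, iteratedDeriv_const_add (by norm_num)]
  refine ⟨g, V, c, Cg, CL / c, hc, hgcont, hVcont, hgc, hgb, hVb, hg₁g ▸ hg₁C, hg₁g ▸ hg₁cpt,
    hg₁g ▸ hg₁supp, fun x ↦ ?_, fun F hF hFsupp ↦ ⟨hgC.mul hF, tsupport_mul_subset_right, fun x ↦ ?_⟩⟩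
  · rw [hg₁g]
    simp only [hVdef]
    rw [div_mul_cancel₀ _ (hg0 x)]
  · -- the `h`-transform identity
    have hball : Ioo ε (2 * π - ε) = ball (π : ℝ) χ.rIn := by
      rw [hrIn, Real.ball_eq_Ioo]; ring_nf
    by_cases hx : x ∈ ball (π : ℝ) χ.rIn
    · -- inside: Leibniz, and `κ g' = -(ρ/2) cot g`
      have hg' : deriv g x = p / 2 * Real.cot (x / 2) * g x := (hasDerivAt_tilt hχ hx).deriv
      have hDgF := deriv_mul_apply (hgC.differentiable (by norm_num) x) (hF.differentiable (by norm_num) x)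
      have hD2gF := iteratedDeriv_two_mul_apply (x := x) hgC.contDiffAt hF.contDiffAt
      simp only [angleGenerator, hVdef, hDg₁, hD2g₁, hDgF, hD2gF]
      have hgx : g x ≠ 0 := hg0 x
      have hκD : (κ : ℝ) * deriv g x = -(ρ / 2) * Real.cot (x / 2) * g x := by
        rw [hg']; linear_combination (Real.cot (x / 2) * g x) * hκp
      have hcancel : ∀ a : ℝ, a / g x * (g x * F x) = a * F x := fun a ↦ by field_simp
      rw [hcancel]
      linear_combination (deriv F x) * hκD
    · -- outside: everything vanishes
      have hxF : x ∉ tsupport F := fun h ↦ hx (hball ▸ hFsupp h)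
      have hxgF : x ∉ tsupport (fun x ↦ g x * F x) := fun h ↦ hxF (tsupport_mul_subset_right h)
      have hF0 : F x = 0 := by
        by_contra h
        exact hxF (subset_tsupport _ (Function.mem_support.2 h))
      rw [angleGenerator_eq_zero_of_notMem_tsupport hxgF, angleGenerator_eq_zero_of_notMem_tsupport hxF, hF0]
      ring

end Exists

end Literature.Probability.RandomPlanarGeometry
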